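import Mathlib
import Literature.NumberTheory.LFunctions.Zhang2022.Section17Eq173Sizes
import HarnessLib

/-!
# Zhang (2022) §17 (17.3): `Φ₃⁺(p) = pΣ_{n<D⁴}ν*(n)ν(n)/n + o(p)` from the term-by-term display
# (§17.u005) and a divisor-type bound on `ν*` — the "by trivial estimation" step, kernel edge

Topic `Literature/NumberTheory/LFunctions/Zhang2022` (Landau–Siegel audit tree; verdict-neutral).
Y. Zhang, *Discrete mean estimates and the Landau–Siegel zero*, arXiv:2211.02515v1 (2022)
[Zhang2022LandauSiegel] — **an unrefereed manuscript under adjudication**; the hypotheses below are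
CLAIM nodes of the manuscript as typed by the cell (`Typed.Section17`), stated not asserted.
§17 p. 96 (tex L4723–L4728; DAG `Z22:§17.u005`, `Z22:(17.3)` of the cell siegel-zhang):

> [u005] `Φ₃⁺(p) = Σ_m Σ_{n<D⁴} (ν*(m)ν(n)/n)(n/m)^{s₀}(Σ*_{ψ (mod p)}ψ(m)ψ̄(n))exp{−𝓛₂²log²(n/m)}
> + O(ε)`. By trivial estimation, the contribution from the terms with `m ≠ n` above is `o(p)`.
> Hence `Φ₃⁺(p) = pΣ_{n<D⁴} ν*(n)ν(n)/n + o(p)`. (17.3)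

This file proves the passage u005 ⇒ (17.3) in the kernel, GIVEN u005 and the divisor-type size
bound `|ν*(n)| ≤ C·n^{1/4}` (uniform; true for the five-fold convolution of `τ₂`-bounded sequences
that `ν*` is (§17.u004), not proved here):

* `claim17_offdiag_of_nuStar_bound` — **"the contribution from the terms with `m ≠ n` is `o(p)`"**
  (the typed inline claim `Claim17_offdiag c′`) from the `ν*`-bound: the off-diagonal part is
  `≤ 4C(Σ_m m^{−5/4})D¹⁶ = o(P) = o(p)` (`offDiagonal_bound_at`, file `Section17Eq173Sizes`);
* `eq17_3_of` — **(17.3) from u005 and the `ν*`-bound**: the u005 double sum splits (tree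
  `SmoothWeight.tsum_eq_diagonal_add_offDiagonal`) into the DIAGONAL, which is EXACTLY
  `(p − 2)·Σ_{n<D⁴}ν*(n)ν(n)/n` (`p − 2` primitive characters mod `p`, `p ∤ n` for `n < D⁴ < p`:
  `Skeleton.sum_finsetOf_p_char_mul_conj`, `SmoothWeight.sum_diagonal_eq`), plus the off-diagonal
  `o(p)`; `2|Σ_{n<D⁴}ν*(n)ν(n)/n| ≤ 2CD⁵ = o(p)` absorbs the difference with the printed factor `p`,
  and the `O(ε) = O(e^{−c𝓛¹⁰})` of u005 is `≤ |C₅| = o(p)`.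

So the node (17.3) reduces to u005 (the contour shift `𝔍(1) → σ = 3/2` + term-by-term integration,
being closed in the cell on `SmoothWeightMellin`/`SmoothWeightSegmentTail`) and the elementary
`ν*`-bound. (17.3) is not itself an input of `Ded1710` — §17.u007 restates it with replaced
coefficients — so this closes the DAG node `Z22:(17.3)` and the inline off-diagonal claim only.
WHAT THIS IS NOT: a proof of u005 or of the `ν*`-bound; any claim about Theorems 1–2 of the source
or about Landau–Siegel zeros; nothing here bears on the cell's verdict on (8.24).

## References

* Y. Zhang, arXiv:2211.02515v1 (2022), §17 p. 96, (17.3). [cite: Zhang2022LandauSiegel, §17 (17.3)]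
-/

noncomputable section

open Complex Real ComplexConjugate Finset
open Literature.NumberTheory.LFunctions.Zhang2022.Skeleton
open Literature.NumberTheory.LFunctions.Zhang2022.Typed.Section17

namespace Literature.NumberTheory.LFunctions.Zhang2022.Phi3Eval

section Main

variable {c' : ℝ}

/-- **"By trivial estimation, the contribution from the terms with `m ≠ n` above is `o(p)`"**
(§17 p. 96, tex L4726) — the typed inline claim `Claim17_offdiag c′` HOLDS given the divisor-type
bound `|ν*(n)| ≤ Cn^{1/4}` (uniform in `D`): the off-diagonal part is `≤ 4CζD¹⁶ = o(P) = o(p)`.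
[cite: Zhang2022LandauSiegel, §17 (17.3) p.96] -/
theorem claim17_offdiag_of_nuStar_bound
    (hν : ∃ C : ℝ, ForAllLarge fun _D _ χ => ∀ n : ℕ, ‖nuStar c' χ n‖ ≤ C * (n : ℝ) ^ (1 / 4 : ℝ)) :
    Claim17_offdiag c' := by
  intro ε hε
  obtain ⟨C, hC⟩ := hν
  set Z : ℝ := ∑' m : ℕ, (m : ℝ) ^ (-(5 / 4 : ℝ)) with hZ
  obtain ⟨D₀, h⟩ := (hC.and (forAllLarge_le_ell 2)).and
    (forAllLarge_const_mul_pow_le (4 * C * Z) hε 16)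
  refine ⟨D₀, fun D _ χ hD hq hprim _hA p hp => ?_⟩
  obtain ⟨⟨eC, hℓ⟩, hpoly⟩ := h D χ hD hq hprim
  have hb := (offDiagonal_bound_at χ hℓ hp eC).2
  have hP : bigP D < p := bigP_lt_of_mem_primeWindow hp
  calc ‖∑' m : ℕ, ∑ n ∈ (Finset.Ico 1 (D ^ 4)).filter (fun n => n ≠ m), term_u005 c' χ p m n‖
      ≤ 4 * C * Z * (D : ℝ) ^ 16 := hb
    _ ≤ ε * bigP D := hpoly
    _ ≤ ε * p := mul_le_mul_of_nonneg_left hP.le hε.le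

/-- **(17.3) from §17.u005 and the `ν*`-bound** (§17 p. 96: "By trivial estimation … Hence
`Φ₃⁺(p) = pΣ_{n<D⁴}ν*(n)ν(n)/n + o(p)` (17.3)"): with `S = Σ_{1≤n<D⁴}ν*(n)ν(n)/n`, the u005 double sum
splits (tree: `SmoothWeight.tsum_eq_diagonal_add_offDiagonal`) into the DIAGONAL, which is EXACTLY
`(p − 2)·S` (`Σ*_{ψ (mod p)}|ψ(n)|² = p − 2` since `p ∤ n` for `1 ≤ n < D⁴ < p`; tree
`Skeleton.sum_finsetOf_p_char_mul_conj`, `SmoothWeight.sum_diagonal_eq`), plus the off-diagonal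
`o(p)` (`claim17_offdiag_of_nuStar_bound`); and `2|S| ≤ 2CD⁵ = o(p)`, `O(e^{−c𝓛¹⁰}) ≤ |C₅| = o(p)`.
[cite: Zhang2022LandauSiegel, §17 (17.3) p.96] -/
theorem eq17_3_of (h5 : Step17_u005 c')
    (hν : ∃ C : ℝ, ForAllLarge fun _D _ χ => ∀ n : ℕ, ‖nuStar c' χ n‖ ≤ C * (n : ℝ) ^ (1 / 4 : ℝ)) :
    Eq17_3 c' := by
  intro ε hε
  obtain ⟨c₅, _hc₅pos, C₅, h5'⟩ := h5
  obtain ⟨C, hC⟩ := hν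
  have hε3 : 0 < ε / 3 := by positivity
  obtain ⟨D₀, h⟩ := ((((h5'.and hC).and (forAllLarge_le_ell 2)).and
    (forAllLarge_const_mul_pow_le (4 * C * ∑' m : ℕ, (m : ℝ) ^ (-(5 / 4 : ℝ))) hε3 16)).and
    (forAllLarge_const_mul_pow_le (2 * C) hε3 5)).and
    (forAllLarge_const_mul_pow_le (|C₅|) hε3 0)
  refine ⟨D₀, fun D _ χ hD hq hprim hA p hp => ?_⟩
  obtain ⟨⟨⟨⟨⟨e5, eC⟩, hℓ⟩, hpoly16⟩, hpoly5⟩, hpoly0⟩ := h D χ hD hq hprim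
  have hP : bigP D < p := bigP_lt_of_mem_primeWindow hp
  have hD4nat : D ^ 4 < p := by
    have := (pow_four_lt_and_log_ge hℓ hp).1
    exact_mod_cast (show ((D ^ 4 : ℕ) : ℝ) < p by push_cast; exact this)
  have hS0 : (0 : ℕ) ∉ Finset.Ico 1 (D ^ 4) := by simp
  -- the typed term = the tree's term (for `n` in the range)
  have hterm : ∀ m n, n ∈ Finset.Ico 1 (D ^ 4) → term_u005 c' χ p m n =
      LSeries.term (nuStar c' χ) (SmoothWeight.s0 (t0 D)) m *
          (nu χ n * (n : ℂ) ^ (SmoothWeight.s0 (t0 D) - 1)) *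
        cexp (-(ell2 D : ℂ) ^ 2 * (Real.log ((n : ℝ) / m) : ℂ) ^ 2) *
        (fun m n : ℕ => ∑ x ∈ chrMod D p, x.ψ (m : ZMod x.p) * conj (x.ψ (n : ZMod x.p))) m n :=
    fun m n hn => term_u005_eq c' χ p m n (by rw [Finset.mem_Ico] at hn; omega)
  have hfunOff : (fun m : ℕ => ∑ n ∈ (Finset.Ico 1 (D ^ 4)).filter (fun n => n ≠ m),
      term_u005 c' χ p m n) = fun m : ℕ => ∑ n ∈ (Finset.Ico 1 (D ^ 4)).filter (fun n => n ≠ m),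
      LSeries.term (nuStar c' χ) (SmoothWeight.s0 (t0 D)) m *
          (nu χ n * (n : ℂ) ^ (SmoothWeight.s0 (t0 D) - 1)) *
        cexp (-(ell2 D : ℂ) ^ 2 * (Real.log ((n : ℝ) / m) : ℂ) ^ 2) *
        (fun m n : ℕ => ∑ x ∈ chrMod D p, x.ψ (m : ZMod x.p) * conj (x.ψ (n : ZMod x.p))) m n :=
    funext fun m => Finset.sum_congr rfl fun n hn => hterm m n (Finset.mem_filter.mp hn).1
  have hfull : ∑' m : ℕ, ∑ n ∈ Finset.Ico 1 (D ^ 4), term_u005 c' χ p m n =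
      ∑' m : ℕ, ∑ n ∈ Finset.Ico 1 (D ^ 4),
        LSeries.term (nuStar c' χ) (SmoothWeight.s0 (t0 D)) m *
            (nu χ n * (n : ℂ) ^ (SmoothWeight.s0 (t0 D) - 1)) *
          cexp (-(ell2 D : ℂ) ^ 2 * (Real.log ((n : ℝ) / m) : ℂ) ^ 2) *
          (fun m n : ℕ => ∑ x ∈ chrMod D p, x.ψ (m : ZMod x.p) * conj (x.ψ (n : ZMod x.p))) m n :=
    tsum_congr fun m => Finset.sum_congr rfl fun n hn => hterm m n hn
  -- off-diagonal: summable and `≤ 4CZ·D¹⁶ ≤ (ε/3)p`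
  have hoffb := offDiagonal_bound_at χ hℓ hp eC
  rw [hfunOff] at hoffb
  obtain ⟨hsum, hoffle⟩ := hoffb
  -- diagonal `= (p − 2)·S`
  have hXd : ∀ n ∈ Finset.Ico 1 (D ^ 4),
      (fun m n : ℕ => ∑ x ∈ chrMod D p, x.ψ (m : ZMod x.p) * conj (x.ψ (n : ZMod x.p))) n n =
        (p : ℂ) - 2 := by
    intro n hn
    rw [Finset.mem_Ico] at hn
    have hndvd : ¬ p ∣ n := fun hdvd => by
      have := Nat.le_of_dvd (by omega) hdvd; omega
    show ∑ x ∈ chrMod D p, x.ψ (n : ZMod x.p) * conj (x.ψ (n : ZMod x.p)) = (p : ℂ) - 2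
    rw [chrMod, sum_finsetOf_p_char_mul_conj hp n n, if_pos ⟨rfl, hndvd⟩, if_pos ⟨hndvd, hndvd⟩]
    ring
  have hdiag := SmoothWeight.sum_diagonal_eq (L₂ := ell2 D) (t0 D) (nuStar c' χ) (nu χ) hS0
    (fun m n : ℕ => ∑ x ∈ chrMod D p, x.ψ (m : ZMod x.p) * conj (x.ψ (n : ZMod x.p))) hXd
  have hsplit := SmoothWeight.tsum_eq_diagonal_add_offDiagonal (L₂ := ell2 D) (t0 D) (nuStar c' χ)
    (nu χ) (fun m n : ℕ => ∑ x ∈ chrMod D p, x.ψ (m : ZMod x.p) * conj (x.ψ (n : ZMod x.p))) hsum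
  rw [hdiag] at hsplit
  -- `hsplit : (tree double sum) = (p − 2)·S + (tree off-diagonal)`
  -- the three pieces
  have hb1 : ‖Phi3plus c' χ p - ∑' m : ℕ, ∑ n ∈ Finset.Ico 1 (D ^ 4), term_u005 c' χ p m n‖ ≤
      ε / 3 * p := by
    refine (e5 hA p hp).trans ?_
    have hexp : Real.exp (-c₅ * ell D ^ 10) ≤ 1 := by
      rw [Real.exp_le_one_iff]
      have : 0 ≤ ell D ^ 10 := by positivity
      nlinarith
    calc C₅ * Real.exp (-c₅ * ell D ^ 10) ≤ |C₅| * 1 := by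
          refine (le_abs_self _).trans ?_
          rw [abs_mul, abs_of_nonneg (Real.exp_nonneg _)]
          exact mul_le_mul_of_nonneg_left hexp (abs_nonneg _)
      _ = |C₅| * (D : ℝ) ^ 0 := by rw [pow_zero]
      _ ≤ ε / 3 * bigP D := hpoly0
      _ ≤ ε / 3 * p := mul_le_mul_of_nonneg_left hP.le hε3.le
  have hb2 := hoffle.trans (hpoly16.trans (mul_le_mul_of_nonneg_left hP.le hε3.le))
  have hb3 : ‖(2 : ℂ) * ∑ n ∈ Finset.Ico 1 (D ^ 4), nuStar c' χ n * nu χ n / (n : ℂ)‖ ≤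
      ε / 3 * p := by
    rw [norm_mul, Complex.norm_two]
    calc 2 * ‖∑ n ∈ Finset.Ico 1 (D ^ 4), nuStar c' χ n * nu χ n / (n : ℂ)‖
        ≤ 2 * (C * (D : ℝ) ^ 5) := mul_le_mul_of_nonneg_left (norm_diagSum_le χ eC) (by norm_num)
      _ = 2 * C * (D : ℝ) ^ 5 := by ring
      _ ≤ ε / 3 * bigP D := hpoly5
      _ ≤ ε / 3 * p := mul_le_mul_of_nonneg_left hP.le hε3.le
  -- assemble: `Φ₃⁺ − pS = (Φ₃⁺ − ΣΣ) + off − 2S`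
  rw [hsplit] at hfull
  have hid : Phi3plus c' χ p -
      (p : ℂ) * ∑ n ∈ Finset.Ico 1 (D ^ 4), nuStar c' χ n * nu χ n / (n : ℂ) =
      (Phi3plus c' χ p - ∑' m : ℕ, ∑ n ∈ Finset.Ico 1 (D ^ 4), term_u005 c' χ p m n) +
        (∑' m : ℕ, ∑ n ∈ (Finset.Ico 1 (D ^ 4)).filter (fun n => n ≠ m),
          LSeries.term (nuStar c' χ) (SmoothWeight.s0 (t0 D)) m *
              (nu χ n * (n : ℂ) ^ (SmoothWeight.s0 (t0 D) - 1)) *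
            cexp (-(ell2 D : ℂ) ^ 2 * (Real.log ((n : ℝ) / m) : ℂ) ^ 2) *
            (fun m n : ℕ => ∑ x ∈ chrMod D p, x.ψ (m : ZMod x.p) * conj (x.ψ (n : ZMod x.p))) m n) -
        2 * ∑ n ∈ Finset.Ico 1 (D ^ 4), nuStar c' χ n * nu χ n / (n : ℂ) := by
    rw [hfull]; ring
  rw [hid]
  refine ((norm_sub_le _ _).trans (add_le_add (norm_add_le _ _) le_rfl)).trans ?_
  calc ‖Phi3plus c' χ p - ∑' m : ℕ, ∑ n ∈ Finset.Ico 1 (D ^ 4), term_u005 c' χ p m n‖ +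
        ‖∑' m : ℕ, ∑ n ∈ (Finset.Ico 1 (D ^ 4)).filter (fun n => n ≠ m),
          LSeries.term (nuStar c' χ) (SmoothWeight.s0 (t0 D)) m *
              (nu χ n * (n : ℂ) ^ (SmoothWeight.s0 (t0 D) - 1)) *
            cexp (-(ell2 D : ℂ) ^ 2 * (Real.log ((n : ℝ) / m) : ℂ) ^ 2) *
            (fun m n : ℕ => ∑ x ∈ chrMod D p, x.ψ (m : ZMod x.p) * conj (x.ψ (n : ZMod x.p))) m n‖ +
        ‖(2 : ℂ) * ∑ n ∈ Finset.Ico 1 (D ^ 4), nuStar c' χ n * nu χ n / (n : ℂ)‖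
      ≤ ε / 3 * p + ε / 3 * p + ε / 3 * p := add_le_add (add_le_add hb1 hb2) hb3
    _ = ε * p := by ring

end Main

end Literature.NumberTheory.LFunctions.Zhang2022.Phi3Eval
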